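import Literature.Geometry.Riemannian.MetricFlowGradientPropertyZeroOfPosAux
import HarnessLib

/-!
# The gradient property for measurable data from the one for `Φ ∘ (Lipschitz)` data
# (Bamler 2023, §3.1, Lemma 3.3)

R. Bamler, *Compactness theory of the space of super Ricci flows*, Invent. Math. 233 (2023), §3.1,
Lemma 3.3 (arXiv v1 Lemma 29): "In Definition 3.2 (6), we may assume that `T > 0` and that `u`
takes values in `(0, 1)`. In this case, we may omit the option that `u_t` is constant."; and the
sentence before it: "Due to Lemma 2.4 (b) [the set of bounded Lipschitz functions `X → ℝ` is dense
in `L^p(X, μ)` for all `p < ∞`] the case `T = 0` in Definition 3.2 (6) follows from `T > 0` by a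
limit argument." Item (6) of Def. 3.2 (the gradient property) asks that for a measurable
`u : 𝒳_s → [0, 1]`, which for `T > 0` is of the form `Φ ∘ f` with `f` `T^{-1/2}`-Lipschitz, the
function `x ↦ ∫ u dν_{x;s}` on `𝒳_t` be constant or of the form `Φ ∘ f'` with `f'`
`(t − s + T)^{-1/2}`-Lipschitz (`Φ` = `MetricFlow.Phi`, its inverse `Φ⁻¹` = `MetricFlow.PhiInv`).

We prove the abstract form of the reduction "`T = 0` follows from `T > 0`" that the limit arguments
of §5–§7 consume (`MetricFlow.const_or_exists_lipschitz_integral_eq_Phi`): let `κ y`, `y ∈ Y`, be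
probability measures on a metric space `X` indexed by a metric space `Y` (in the application,
`κ y = ν_{y;s}` on `X = 𝒳_s` for `y` in `Y = 𝒳_t`). If for every Lipschitz `f : X → ℝ` the function
`y ↦ ∫ Φ ∘ f dκ y` is constant or equals `Φ ∘ f'` with `f'` `L`-Lipschitz, then the same holds
for `y ↦ ∫ u dκ y` for every measurable `u : X → [0, 1]`.

The limit argument, made explicit: fix `y₁, y₂` and approximate `u` in `L¹(κ y₁ + κ y₂)` by
functions `Φ ∘ fₙ` with `fₙ` Lipschitz (`exists_seq_lipschitzWith_tendsto_lintegral_Phi_sub` of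
`MetricFlowGradientPropertyZeroOfPosAux.lean`, from Lemma 2.4 (b)). The hypothesis gives, for each
`n` and in both alternatives, `|Φ⁻¹(aₙ) − Φ⁻¹(bₙ)| ≤ L d(y₁, y₂)` for the approximating integrals
`aₙ → ∫ u dκ y₁`, `bₙ → ∫ u dκ y₂`, which lie in `(0, 1)` (`integral_Phi_comp_mem_Ioo`). Passing
to the limit: if both limits lie in `(0, 1)` the same inequality holds for them (continuity of
`Φ⁻¹`, `abs_PhiInv_sub_le_of_tendsto`); if one limit is `0` (resp. `1`) then `Φ⁻¹(aₙ) → ∓∞`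
drags `Φ⁻¹(bₙ)` along, so the other limit is `0` (resp. `1`) too
(`eq_zero_of_tendsto_of_abs_PhiInv_sub_le`, `eq_one_of_tendsto_of_abs_PhiInv_sub_le`). Hence
either some `∫ u dκ y₀ ∈ {0, 1}` and `y ↦ ∫ u dκ y` is constant, or all values lie in `(0, 1)` and
`Φ⁻¹ ∘ (y ↦ ∫ u dκ y)` is `L`-Lipschitz.

Everything is proved; no definitions, no named facts.

## References

* R. H. Bamler, *Compactness theory of the space of super Ricci flows*, Invent. Math. 233 (2023),
  1121–1277 (arXiv:2008.09298), §2.3, Lemma 2.4 (b); §3.1, Def. 3.2 (6) and Lemma 3.3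
  (arXiv v1 Lemma 29). [Bamler2023]
-/

noncomputable section

open Set MeasureTheory Filter TopologicalSpace Function
open scoped Topology ENNReal NNReal

namespace Literature.Geometry.Riemannian

universe u

namespace MetricFlow

/-! ### Passing `|Φ⁻¹ a − Φ⁻¹ b| ≤ D` to the limit -/

/-- If `aₙ → A ∈ (0, 1)`, `bₙ → B ∈ (0, 1)` and `|Φ⁻¹ aₙ − Φ⁻¹ bₙ| ≤ D`, then
`|Φ⁻¹ A − Φ⁻¹ B| ≤ D` (continuity of `Φ⁻¹` on `(0, 1)`).
[cite: Bamler2023, §3.1, Lemma 3.3 (arXiv v1 Lemma 29)] -/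
theorem abs_PhiInv_sub_le_of_tendsto {a b : ℕ → ℝ} {A B D : ℝ} (hA : A ∈ Ioo (0 : ℝ) 1)
    (hB : B ∈ Ioo (0 : ℝ) 1) (ha : Tendsto a atTop (𝓝 A)) (hb : Tendsto b atTop (𝓝 B))
    (hD : ∀ n, |PhiInv (a n) - PhiInv (b n)| ≤ D) : |PhiInv A - PhiInv B| ≤ D :=
  le_of_tendsto' ((tendsto_PhiInv_comp hA.1 hA.2 ha).sub (tendsto_PhiInv_comp hB.1 hB.2 hb)).abs hD

/-- If `aₙ, bₙ ∈ (0, 1)`, `aₙ → 0`, `bₙ → B` and `|Φ⁻¹ aₙ − Φ⁻¹ bₙ| ≤ D`, then `B = 0`: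
`Φ⁻¹ aₙ → −∞` forces `Φ⁻¹ bₙ → −∞`, i.e. `bₙ = Φ(Φ⁻¹ bₙ) → 0`.
[cite: Bamler2023, §3.1, Lemma 3.3 (arXiv v1 Lemma 29)] -/
theorem eq_zero_of_tendsto_of_abs_PhiInv_sub_le {a b : ℕ → ℝ} {B D : ℝ}
    (ha01 : ∀ n, a n ∈ Ioo (0 : ℝ) 1) (hb01 : ∀ n, b n ∈ Ioo (0 : ℝ) 1)
    (ha : Tendsto a atTop (𝓝 0)) (hb : Tendsto b atTop (𝓝 B))
    (hD : ∀ n, |PhiInv (a n) - PhiInv (b n)| ≤ D) : B = 0 := by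
  have h1 : Tendsto (fun n ↦ PhiInv (a n)) atTop atBot :=
    tendsto_PhiInv_nhdsGT_zero.comp
      (tendsto_nhdsWithin_iff.2 ⟨ha, Eventually.of_forall fun n ↦ (ha01 n).1⟩)
  have h2 : Tendsto (fun n ↦ PhiInv (b n)) atTop atBot :=
    tendsto_atBot_mono (fun n ↦ by linarith [(abs_sub_le_iff.1 (hD n)).2])
      (tendsto_atBot_add_const_right _ D h1)
  have h3 : Tendsto b atTop (𝓝 0) :=
    (tendsto_Phi_atBot.comp h2).congr fun n ↦ Phi_PhiInv (hb01 n).1 (hb01 n).2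
  exact tendsto_nhds_unique hb h3

/-- If `aₙ, bₙ ∈ (0, 1)`, `aₙ → 1`, `bₙ → B` and `|Φ⁻¹ aₙ − Φ⁻¹ bₙ| ≤ D`, then `B = 1`:
`Φ⁻¹ aₙ → +∞` forces `Φ⁻¹ bₙ → +∞`, i.e. `bₙ = Φ(Φ⁻¹ bₙ) → 1`.
[cite: Bamler2023, §3.1, Lemma 3.3 (arXiv v1 Lemma 29)] -/
theorem eq_one_of_tendsto_of_abs_PhiInv_sub_le {a b : ℕ → ℝ} {B D : ℝ}
    (ha01 : ∀ n, a n ∈ Ioo (0 : ℝ) 1) (hb01 : ∀ n, b n ∈ Ioo (0 : ℝ) 1)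
    (ha : Tendsto a atTop (𝓝 1)) (hb : Tendsto b atTop (𝓝 B))
    (hD : ∀ n, |PhiInv (a n) - PhiInv (b n)| ≤ D) : B = 1 := by
  have h1 : Tendsto (fun n ↦ PhiInv (a n)) atTop atTop :=
    tendsto_PhiInv_nhdsLT_one.comp
      (tendsto_nhdsWithin_iff.2 ⟨ha, Eventually.of_forall fun n ↦ (ha01 n).2⟩)
  have h2 : Tendsto (fun n ↦ PhiInv (b n)) atTop atTop :=
    tendsto_atTop_mono (fun n ↦ by linarith [(abs_sub_le_iff.1 (hD n)).1])
      (tendsto_atTop_add_const_right _ (-D) h1)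
  have h3 : Tendsto b atTop (𝓝 1) :=
    (tendsto_Phi_atTop.comp h2).congr fun n ↦ Phi_PhiInv (hb01 n).1 (hb01 n).2
  exact tendsto_nhds_unique hb h3

/-- `∫ Φ ∘ f dμ ∈ (0, 1)` for a probability measure `μ` and measurable `f` (`0 < Φ < 1`).
[cite: Bamler2023, §3.1, Lemma 3.3 (arXiv v1 Lemma 29)] -/
theorem integral_Phi_comp_mem_Ioo {X : Type*} [MeasurableSpace X] (μ : Measure X)
    [IsProbabilityMeasure μ] {f : X → ℝ} (hf : Measurable f) :
    ∫ x, Phi (f x) ∂μ ∈ Ioo (0 : ℝ) 1 := by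
  have hm : Measurable fun x ↦ Phi (f x) := contDiff_Phi.continuous.measurable.comp hf
  have hint : Integrable (fun x ↦ Phi (f x)) μ :=
    Integrable.of_mem_Icc 0 1 hm.aemeasurable (ae_of_all _ fun x ↦ Phi_mem_Icc (f x))
  constructor
  · rw [integral_pos_iff_support_of_nonneg (fun x ↦ (Phi_pos (f x)).le) hint,
      (eq_univ_of_forall fun x ↦ (Phi_pos (f x)).ne' : support (fun x ↦ Phi (f x)) = univ)]
    simp
  · have hint' : Integrable (fun x ↦ 1 - Phi (f x)) μ := (integrable_const 1).sub hint
    have hpos : 0 < ∫ x, 1 - Phi (f x) ∂μ := by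
      rw [integral_pos_iff_support_of_nonneg (fun x ↦ sub_nonneg.2 (Phi_lt_one (f x)).le) hint',
        (eq_univ_of_forall fun x ↦ (sub_pos.2 (Phi_lt_one (f x))).ne' :
          support (fun x ↦ 1 - Phi (f x)) = univ)]
      simp
    rw [integral_sub (integrable_const 1) hint] at hpos
    simp only [integral_const, smul_eq_mul, mul_one, probReal_univ] at hpos
    linarith

/-! ### Lemma 3.3 (arXiv v1 Lemma 29), abstract form -/

/-- **Bamler 2023, Lemma 3.3 (arXiv v1 Lemma 29): in the gradient property (Def. 3.2 (6)) one may
assume `T > 0`, i.e. data `u = Φ ∘ f` with `f` Lipschitz** — abstract form for a family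
`κ y`, `y ∈ Y`, of probability measures on a metric space `X` indexed by a metric space `Y`: if for
every Lipschitz `f : X → ℝ` the function `y ↦ ∫ Φ ∘ f dκ y` is constant or of the form `Φ ∘ f'`
with `f'` `L`-Lipschitz, then for every measurable `u : X → [0, 1]` the function `y ↦ ∫ u dκ y` is
constant or of the form `Φ ∘ f'` with `f'` `L`-Lipschitz ("Due to Lemma 2.4 (b) the case `T = 0`
… follows from `T > 0` by a limit argument": approximate `u` in `L¹(κ y₁ + κ y₂)` by `Φ ∘ fₙ`,
`fₙ` Lipschitz, and pass the pairwise bound `|Φ⁻¹(∫ Φ∘fₙ dκ y₁) − Φ⁻¹(∫ Φ∘fₙ dκ y₂)| ≤ L d(y₁, y₂)`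
to the limit). [cite: Bamler2023, §3.1, Lemma 3.3 (arXiv v1 Lemma 29)] -/
theorem const_or_exists_lipschitz_integral_eq_Phi
    {X Y : Type*} [MetricSpace X] [MeasurableSpace X] [BorelSpace X] [MetricSpace Y]
    (κ : Y → Measure X) [∀ y, IsProbabilityMeasure (κ y)] (L : ℝ≥0)
    (hpos : ∀ (K : ℝ≥0) (f : X → ℝ), LipschitzWith K f →
      (∃ c, ∀ y, ∫ x, MetricFlow.Phi (f x) ∂κ y = c) ∨
        ∃ f' : Y → ℝ, LipschitzWith L f' ∧
          ∀ y, ∫ x, MetricFlow.Phi (f x) ∂κ y = MetricFlow.Phi (f' y))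
    (u : X → ℝ) (hu : Measurable u) (h01 : ∀ x, u x ∈ Icc (0 : ℝ) 1) :
    (∃ c, ∀ y, ∫ x, u x ∂κ y = c) ∨
      ∃ f' : Y → ℝ, LipschitzWith L f' ∧ ∀ y, ∫ x, u x ∂κ y = MetricFlow.Phi (f' y) := by
  -- pairwise approximating integrals `aₙ → ∫ u dκ y₁`, `bₙ → ∫ u dκ y₂` with the Lipschitz bound
  have key : ∀ y₁ y₂ : Y, ∃ a b : ℕ → ℝ, (∀ n, a n ∈ Ioo (0 : ℝ) 1) ∧ (∀ n, b n ∈ Ioo (0 : ℝ) 1) ∧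
      Tendsto a atTop (𝓝 (∫ x, u x ∂κ y₁)) ∧ Tendsto b atTop (𝓝 (∫ x, u x ∂κ y₂)) ∧
      ∀ n, |PhiInv (a n) - PhiInv (b n)| ≤ L * dist y₁ y₂ := by
    intro y₁ y₂
    obtain ⟨f, hfK, hlim⟩ :=
      exists_seq_lipschitzWith_tendsto_lintegral_Phi_sub (κ y₁ + κ y₂) hu h01
    have hfm : ∀ n, Measurable (f n) := fun n ↦ (hfK n).choose_spec.continuous.measurable
    have hint : ∀ (y : Y) (n : ℕ), Integrable (fun x ↦ Phi (f n x)) (κ y) := fun y n ↦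
      Integrable.of_mem_Icc 0 1 (contDiff_Phi.continuous.measurable.comp (hfm n)).aemeasurable
        (ae_of_all _ fun x ↦ Phi_mem_Icc (f n x))
    refine ⟨fun n ↦ ∫ x, Phi (f n x) ∂κ y₁, fun n ↦ ∫ x, Phi (f n x) ∂κ y₂,
      fun n ↦ integral_Phi_comp_mem_Ioo (κ y₁) (hfm n),
      fun n ↦ integral_Phi_comp_mem_Ioo (κ y₂) (hfm n),
      tendsto_integral_of_tendsto_lintegral_enorm_sub (Measure.le_add_right le_rfl) (hint y₁)
        hu.aestronglyMeasurable hlim,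
      tendsto_integral_of_tendsto_lintegral_enorm_sub (Measure.le_add_left le_rfl) (hint y₂)
        hu.aestronglyMeasurable hlim,
      fun n ↦ ?_⟩
    obtain ⟨K, hK⟩ := hfK n
    dsimp only
    rcases hpos K (f n) hK with ⟨c, hc⟩ | ⟨f', hf', hf'eq⟩
    · rw [hc y₁, hc y₂, sub_self, abs_zero]
      positivity
    · rw [hf'eq y₁, hf'eq y₂, PhiInv_Phi, PhiInv_Phi, ← Real.dist_eq]
      exact hf'.dist_le_mul y₁ y₂
  have hg01 : ∀ y, ∫ x, u x ∂κ y ∈ Icc (0 : ℝ) 1 := fun y ↦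
    ⟨integral_nonneg fun x ↦ (h01 x).1,
      (integral_mono (Integrable.of_mem_Icc 0 1 hu.aemeasurable (ae_of_all _ h01))
        (integrable_const 1) fun x ↦ (h01 x).2).trans_eq (by simp)⟩
  by_cases hall : ∀ y, ∫ x, u x ∂κ y ∈ Ioo (0 : ℝ) 1
  · -- all values in `(0, 1)`: `Φ⁻¹ ∘ (y ↦ ∫ u dκ y)` is `L`-Lipschitz
    refine Or.inr ⟨fun y ↦ PhiInv (∫ x, u x ∂κ y), LipschitzWith.of_dist_le_mul fun y₁ y₂ ↦ ?_,
      fun y ↦ (Phi_PhiInv (hall y).1 (hall y).2).symm⟩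
    obtain ⟨a, b, ha, hb, haA, hbB, hD⟩ := key y₁ y₂
    rw [Real.dist_eq]
    exact abs_PhiInv_sub_le_of_tendsto (hall y₁) (hall y₂) haA hbB hD
  · -- some value is `0` or `1`: then all values agree with it
    obtain ⟨y₀, hy₀⟩ := not_forall.1 hall
    refine Or.inl ⟨∫ x, u x ∂κ y₀, fun y ↦ ?_⟩
    obtain ⟨a, b, ha, hb, haA, hbB, hD⟩ := key y₀ y
    rcases (hg01 y₀).1.eq_or_lt with h0 | h0
    · rw [← h0] at haA ⊢
      exact eq_zero_of_tendsto_of_abs_PhiInv_sub_le ha hb haA hbB hD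
    · have h1 : ∫ x, u x ∂κ y₀ = 1 := by
        by_contra hne
        exact hy₀ ⟨h0, lt_of_le_of_ne (hg01 y₀).2 hne⟩
      rw [h1] at haA ⊢
      exact eq_one_of_tendsto_of_abs_PhiInv_sub_le ha hb haA hbB hD

end MetricFlow

end Literature.Geometry.Riemannian

end
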